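import Summits.QuantumFields.YangMills.Theorems.ColdStartUniversalityShenZhuZhuFunctionalInequalitiesSU2
import Summits.QuantumFields.YangMills.Theorems.ColdStartUniversalityLatticeLangevinBakryEmeryHessian
import HarnessLib

/-!
# Route `ColdStartUniversality` (fixed-cut-off package): THE NAMED FACT `shenZhuZhu_bakryEmery_transfer 3 2` IS A THEOREM —
# Shen–Zhu–Zhu's Bakry–Émery step (Theorem 4.2 / Corollary 4.5 with the Hessian constant as a parameter) for `SU(2)` lattice Yang–Mills in `d = 3`

Helper file (seat `ym-line-csu-p1`, g38; `--supports stmt-QuantumFields-24809`).  `Literature…LatticeYangMillsBakryEmery` types Shen–Zhu–Zhu's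
"by the Bakry–Émery criterion" step as the NAMED FACT `shenZhuZhu_bakryEmery_transfer d N`: IF the Wilson plaquette sum satisfies
`|Hess(v,v)| ≤ Λ₀ |v|²` on every torus (`WilsonHessianBound d N Λ₀`, second derivative along `t ↦ e^(tX)Q`), THEN every infinite-volume limit
point at tree coupling `Nβ` satisfies log-Sobolev`(2/K)` and Poincaré`(1/K)` in Lipschitz form with `K = N/2 − N|β|Λ₀ > 0`
(`SZZFunctionalInequalitiesWith d N β K`) — "the general Bakry–Émery criterion on a compact Riemannian manifold is not in the tree".
The venture `YMGap` proves the hypothesis with `Λ₀ = 4d` in the kernel and draws the window `|β| < 1/(8d)` CONDITIONALLY on this fact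
(`Thresholds/SharpWindow`, `SharpLargeN`, `SharpLargeNLoops`, `SharpMassGap`).  For `SU(2)`, `d = 3` the seat's fixed-cut-off Bakry–Émery
package is that criterion:
* ★★ `hessBound_of_wilsonHessianBound` — `WilsonHessianBound 3 2 Λ₀` ⇒ the frame-Hessian hypothesis `hHess` of the g25/g26 files with
  `K₀ = 2Λ₀|β'|` on every torus (g25's `fderiv_frameDeriv_eq_mul_hessianForm` + the venture's `iteratedDeriv_two_wilsonRe`; g25's
  `wilson_hessBound` is the instance `Λ₀ = 12`);
* ★★★ `shenZhuZhu_bakryEmery_transfer_su2_d3 : shenZhuZhu_bakryEmery_transfer 3 2` — THE NAMED FACT for `SU(2)`, `d = 3`, UNCONDITIONAL: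
  every `Λ₀ ≥ 0` with `WilsonHessianBound 3 2 Λ₀` and every `β` with `K = 1 − 2|β|Λ₀ > 0` give `SZZFunctionalInequalitiesWith 3 2 β K`
  (`szzFunctionalInequalitiesWith_su2_of_hessBound` at `K₀ = 2Λ₀|2β|`).  Consequently the venture's conditional `SU(2)`, `d = 3` statements
  (sharp window `1/24`, plaquette / Wilson-loop variance bounds) hold with this theorem in place of their hypothesis `h`.
THEOREMS ONLY, no definition, no sorry.  HONEST FRAMING: STRONG-coupling, fixed-lattice statements; nothing at weak coupling or in the
continuum, nothing `K`-uniform along the route's scaling (`UniformColdStartMixing`, 24809, ASIDE, not restated); no crux, rung or summit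
statement is proved; the Yang–Mills mass gap is NOT proved.
-/

set_option autoImplicit false

noncomputable section

namespace Summit.QuantumFields.YangMills.Theorems.ColdStartUniversality

open MeasureTheory Matrix Complex Finset
open scoped ComplexConjugate BigOperators Matrix
open Literature.MathematicalPhysics.QuantumFieldTheory
open Literature.MathematicalPhysics.QuantumLattice (fundamentalRep fundamentalLatticeRep continuous_fundamentalRep fundamentalRep_apply)
open Summit.Ventures.YMGap.HessianSharp (perturb wilsonRe plaqRe plaqReDeriv plaqHess hessianForm tangentNormSq frobSq
  hasDerivAt_wilsonRe_perturb hasDerivAt_plaqReDeriv_zero iteratedDeriv_two_wilsonRe)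

variable {L : ℕ} [NeZero L]

/-! ## §1. From `WilsonHessianBound 3 2 Λ₀` to the frame-Hessian hypothesis `hHess` with `K₀ = 2Λ₀|β'|` -/

/-- ★★ **The frame-Hessian hypothesis of the Bakry–Émery files from Shen–Zhu–Zhu's Hessian bound with a constant `Λ₀`.**  If
`WilsonHessianBound 3 2 Λ₀` holds (the named-fact HYPOTHESIS of `shenZhuZhu_bakryEmery_transfer`: on every torus
`|d²/dt²|₀ Σ_p Re tr hol_p(e^(tX)Q)| ≤ Λ₀ Σ_e tr(X_eX_eᴴ)` for `X ∈ 𝔰𝔲(2)^E`), then for every `L`, `β'`, configuration `V` and functional `Λ`: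
`Σ_(n,m) Λ(s_n)Λ(s_m)·(W_n W_m ψ̂)(coords V) ≤ 2Λ₀|β'|·Σ_n Λ(s_n)²` — hypothesis `hHess` of `wilson_generatorPoincare/LogSobolev_of_hessBound` with
`K₀ = 2Λ₀|β'|` (the left side is `β'·hessianForm(Q, A)` = `β'·(Σ_p Re tr hol_p(e^(tA)V))''(0)` for `A_e = √2 Σ_ν Λ(s_(e,ν)) 𝐩E_ν`, g25's
`fderiv_frameDeriv_eq_mul_hessianForm` and the venture's `iteratedDeriv_two_wilsonRe`; `Σ_e‖A_e‖² ≤ 2Σ_nΛ(s_n)²`).  The g25 theorem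
`wilson_hessBound` is the instance `Λ₀ = 12` supplied by the venture's kernel theorem. [cite: ShenZhuZhu2022, §4 Lemma 4.1 and (4.7)] -/
theorem hessBound_of_wilsonHessianBound (Λ₀ : ℝ) (hΛ : 0 ≤ Λ₀) (hH : WilsonHessianBound 3 2 Λ₀) (L : ℕ) [NeZero L] (β' : ℝ) :
    (∀ (V : (GaugeConfig 3 L (Matrix.specialUnitaryGroup (Fin 2) ℂ))) (Λ : (Edge 3 L × Fin (fundamentalLatticeRep 2).N × Fin (fundamentalLatticeRep 2).N × Bool → ℝ) →L[ℝ] ℝ),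
      ∑ n : Edge 3 L × NoiseIdx (fundamentalLatticeRep 2).N, ∑ m : Edge 3 L × NoiseIdx (fundamentalLatticeRep 2).N,
        Λ ((fun q : Edge 3 L × Fin (fundamentalLatticeRep 2).N × Fin (fundamentalLatticeRep 2).N × Bool => if n.1 = q.1 then (fun z : ℂ => if q.2.2.2 then z.im else z.re) (((Real.sqrt 2 : ℂ) • ((fundamentalLatticeRep 2).lieProj (noiseDir n.2) * (fun (ee : Edge 3 L) => Matrix.of fun (i j : Fin (fundamentalLatticeRep 2).N) => (((fun (V : GaugeConfig 3 L (Matrix.specialUnitaryGroup (Fin 2) ℂ)) (q : Edge 3 L × Fin (fundamentalLatticeRep 2).N × Fin (fundamentalLatticeRep 2).N × Bool) => (fun z : ℂ => if q.2.2.2 then z.im else z.re) ((fundamentalRep (Fin 2) (V q.1) : Matrix (Fin 2) (Fin 2) ℂ) q.2.1 q.2.2.1)) V (ee, i, j, false) : ℝ) : ℂ) + (((fun (V : GaugeConfig 3 L (Matrix.specialUnitaryGroup (Fin 2) ℂ)) (q : Edge 3 L × Fin (fundamentalLatticeRep 2).N × Fin (fundamentalLatticeRep 2).N × Bool) => (fun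 z : ℂ => if q.2.2.2 then z.im else z.re) ((fundamentalRep (Fin 2) (V q.1) : Matrix (Fin 2) (Fin 2) ℂ) q.2.1 q.2.2.1)) V (ee, i, j, true) : ℝ) : ℂ) * Complex.I) q.1)) q.2.1 q.2.2.1) else 0)) * Λ ((fun q : Edge 3 L × Fin (fundamentalLatticeRep 2).N × Fin (fundamentalLatticeRep 2).N × Bool => if m.1 = q.1 then (fun z : ℂ => if q.2.2.2 then z.im else z.re) (((Real.sqrt 2 : ℂ) • ((fundamentalLatticeRep 2).lieProj (noiseDir m.2) * (fun (ee : Edge 3 L) => Matrix.of fun (i j : Fin (fundamentalLatticeRep 2).N) => (((fun (V : GaugeConfig 3 L (Matrix.specialUnitaryGroup (Fin 2) ℂ)) (q : Edge 3 L × Fin (fundamentalLatticeRep 2).N × Fin (fundamentalLatticeRep 2).N × Bool) => (fun z : ℂ => if q.2.2.2 then z.im else z.re) ((fundamentalRep (Fin 2) (V q.1) : Matrix (Fin 2) (Fin 2) ℂ) q.2.1 q.2.2.1)) V (ee, i, j, false) : ℝ) : ℂ) + (((fun (V : GaugeConfig 3 L (Matrix.specialUnitaryGroup (Fin 2) ℂ))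 (q : Edge 3 L × Fin (fundamentalLatticeRep 2).N × Fin (fundamentalLatticeRep 2).N × Bool) => (fun z : ℂ => if q.2.2.2 then z.im else z.re) ((fundamentalRep (Fin 2) (V q.1) : Matrix (Fin 2) (Fin 2) ℂ) q.2.1 q.2.2.1)) V (ee, i, j, true) : ℝ) : ℂ) * Complex.I) q.1)) q.2.1 q.2.2.1) else 0)) *
          fderiv ℝ (fun z : (Edge 3 L × Fin (fundamentalLatticeRep 2).N × Fin (fundamentalLatticeRep 2).N × Bool → ℝ) => fderiv ℝ (fun y : (Edge 3 L × Fin (fundamentalLatticeRep 2).N × Fin (fundamentalLatticeRep 2).N × Bool → ℝ) => β' * ∑ p : Plaquette 3 L, (rootedLoop (fun (ee : Edge 3 L) (i j : Fin (fundamentalLatticeRep 2).N) => ((y (ee, i, j, false) : ℝ) : ℂ) + ((y (ee, i, j, true) : ℝ) : ℂ) * Complex.I) (p.1, p.2.1.1) p.2.1.2 false).trace.re) z (fun q : Edge 3 L × Fin (fundamentalLatticeRep 2).N × Fin (fundamentalLatticeRep 2).N × Bool => if m.1 = q.1 then (fun z : ℂ => if q.2.2.2 then z.im else z.re) (((Real.sqrt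 2 : ℂ) • ((fundamentalLatticeRep 2).lieProj (noiseDir m.2) * (fun (ee : Edge 3 L) => Matrix.of fun (i j : Fin (fundamentalLatticeRep 2).N) => ((z (ee, i, j, false) : ℝ) : ℂ) + ((z (ee, i, j, true) : ℝ) : ℂ) * Complex.I) q.1)) q.2.1 q.2.2.1) else 0)) ((fun (V : GaugeConfig 3 L (Matrix.specialUnitaryGroup (Fin 2) ℂ)) (q : Edge 3 L × Fin (fundamentalLatticeRep 2).N × Fin (fundamentalLatticeRep 2).N × Bool) => (fun z : ℂ => if q.2.2.2 then z.im else z.re) ((fundamentalRep (Fin 2) (V q.1) : Matrix (Fin 2) (Fin 2) ℂ) q.2.1 q.2.2.1)) V) (fun q : Edge 3 L × Fin (fundamentalLatticeRep 2).N × Fin (fundamentalLatticeRep 2).N × Bool => if n.1 = q.1 then (fun z : ℂ => if q.2.2.2 then z.im else z.re) (((Real.sqrt 2 : ℂ) • ((fundamentalLatticeRep 2).lieProj (noiseDir n.2) * (fun (ee : Edge 3 L) => Matrix.of fun (i j : Fin (fundamentalLatticeRep 2).N) => (((fun (V : GaugeConfig 3 L (Matrix.specialUnitaryGroup (Fin 2)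 ℂ)) (q : Edge 3 L × Fin (fundamentalLatticeRep 2).N × Fin (fundamentalLatticeRep 2).N × Bool) => (fun z : ℂ => if q.2.2.2 then z.im else z.re) ((fundamentalRep (Fin 2) (V q.1) : Matrix (Fin 2) (Fin 2) ℂ) q.2.1 q.2.2.1)) V (ee, i, j, false) : ℝ) : ℂ) + (((fun (V : GaugeConfig 3 L (Matrix.specialUnitaryGroup (Fin 2) ℂ)) (q : Edge 3 L × Fin (fundamentalLatticeRep 2).N × Fin (fundamentalLatticeRep 2).N × Bool) => (fun z : ℂ => if q.2.2.2 then z.im else z.re) ((fundamentalRep (Fin 2) (V q.1) : Matrix (Fin 2) (Fin 2) ℂ) q.2.1 q.2.2.1)) V (ee, i, j, true) : ℝ) : ℂ) * Complex.I) q.1)) q.2.1 q.2.2.1) else 0)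
        ≤ (2 * Λ₀ * |β'|) * ∑ n : Edge 3 L × NoiseIdx (fundamentalLatticeRep 2).N, (Λ (fun q : Edge 3 L × Fin (fundamentalLatticeRep 2).N × Fin (fundamentalLatticeRep 2).N × Bool => if n.1 = q.1 then (fun z : ℂ => if q.2.2.2 then z.im else z.re) (((Real.sqrt 2 : ℂ) • ((fundamentalLatticeRep 2).lieProj (noiseDir n.2) * (fun (ee : Edge 3 L) => Matrix.of fun (i j : Fin (fundamentalLatticeRep 2).N) => (((fun (V : GaugeConfig 3 L (Matrix.specialUnitaryGroup (Fin 2) ℂ)) (q : Edge 3 L × Fin (fundamentalLatticeRep 2).N × Fin (fundamentalLatticeRep 2).N × Bool) => (fun z : ℂ => if q.2.2.2 then z.im else z.re) ((fundamentalRep (Fin 2) (V q.1) : Matrix (Fin 2) (Fin 2) ℂ) q.2.1 q.2.2.1)) V (ee, i, j, false) : ℝ) : ℂ) + (((fun (V : GaugeConfig 3 L (Matrix.specialUnitaryGroup (Fin 2) ℂ)) (q : Edge 3 L × Fin (fundamentalLatticeRep 2).N × Fin (fundamentalLatticeRep 2).N × Bool) => (fun z : ℂ => if q.2.2.2 then z.im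 else z.re) ((fundamentalRep (Fin 2) (V q.1) : Matrix (Fin 2) (Fin 2) ℂ) q.2.1 q.2.2.1)) V (ee, i, j, true) : ℝ) : ℂ) * Complex.I) q.1)) q.2.1 q.2.2.1) else 0)) ^ 2) := by
  intro V Λ
  classical
  obtain ⟨s, c, hs, -, -, -, -⟩ := exists_noiseFrame L
  -- abbreviations
  set P : NoiseIdx (fundamentalLatticeRep 2).N → Matrix (Fin (fundamentalLatticeRep 2).N) (Fin (fundamentalLatticeRep 2).N) ℂ := fun ν => (fundamentalLatticeRep 2).lieProj (noiseDir ν) with hP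
  set reb : (Edge 3 L × Fin (fundamentalLatticeRep 2).N × Fin (fundamentalLatticeRep 2).N × Bool → ℝ) → (Edge 3 L → Matrix (Fin (fundamentalLatticeRep 2).N) (Fin (fundamentalLatticeRep 2).N) ℂ) := fun z => (fun (ee : Edge 3 L) => Matrix.of fun (i j : Fin (fundamentalLatticeRep 2).N) => ((z (ee, i, j, false) : ℝ) : ℂ) + ((z (ee, i, j, true) : ℝ) : ℂ) * Complex.I) with hreb
  set flat : (Edge 3 L → Matrix (Fin (fundamentalLatticeRep 2).N) (Fin (fundamentalLatticeRep 2).N) ℂ) → (Edge 3 L × Fin (fundamentalLatticeRep 2).N × Fin (fundamentalLatticeRep 2).N × Bool → ℝ) := fun M => (fun q : Edge 3 L × Fin (fundamentalLatticeRep 2).N × Fin (fundamentalLatticeRep 2).N × Bool => (fun z : ℂ => if q.2.2.2 then z.im else z.re) (M q.1 q.2.1 q.2.2.1)) with hflat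
  set σ : (Edge 3 L × NoiseIdx (fundamentalLatticeRep 2).N) → (Edge 3 L × Fin (fundamentalLatticeRep 2).N × Fin (fundamentalLatticeRep 2).N × Bool → ℝ) → (Edge 3 L × Fin (fundamentalLatticeRep 2).N × Fin (fundamentalLatticeRep 2).N × Bool → ℝ) := fun n z => (fun q : Edge 3 L × Fin (fundamentalLatticeRep 2).N × Fin (fundamentalLatticeRep 2).N × Bool => if n.1 = q.1 then (fun z : ℂ => if q.2.2.2 then z.im else z.re) (((Real.sqrt 2 : ℂ) • ((fundamentalLatticeRep 2).lieProj (noiseDir n.2) * (fun (ee : Edge 3 L) => Matrix.of fun (i j : Fin (fundamentalLatticeRep 2).N) => ((z (ee, i, j, false) : ℝ) : ℂ) + ((z (ee, i, j, true) : ℝ) : ℂ) * Complex.I) q.1)) q.2.1 q.2.2.1) else 0) with hσ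
  set ψ : (Edge 3 L × Fin (fundamentalLatticeRep 2).N × Fin (fundamentalLatticeRep 2).N × Bool → ℝ) → ℝ := (fun y : (Edge 3 L × Fin (fundamentalLatticeRep 2).N × Fin (fundamentalLatticeRep 2).N × Bool → ℝ) => β' * ∑ p : Plaquette 3 L, (rootedLoop (fun (ee : Edge 3 L) (i j : Fin (fundamentalLatticeRep 2).N) => ((y (ee, i, j, false) : ℝ) : ℂ) + ((y (ee, i, j, true) : ℝ) : ℂ) * Complex.I) (p.1, p.2.1.1) p.2.1.2 false).trace.re) with hψ
  set y : (Edge 3 L × Fin (fundamentalLatticeRep 2).N × Fin (fundamentalLatticeRep 2).N × Bool → ℝ) := (fun (V : GaugeConfig 3 L (Matrix.specialUnitaryGroup (Fin 2) ℂ)) (q : Edge 3 L × Fin (fundamentalLatticeRep 2).N × Fin (fundamentalLatticeRep 2).N × Bool) => (fun z : ℂ => if q.2.2.2 then z.im else z.re) ((fundamentalRep (Fin 2) (V q.1) : Matrix (Fin 2) (Fin 2) ℂ) q.2.1 q.2.2.1)) V with hy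
  have hsσ : ∀ n z, s n z = σ n z := fun n z => hs n z
  -- §1 facts of `…NoiseFrame` in the abbreviations
  have r_smul : ∀ (a : ℝ) (v : (Edge 3 L × Fin (fundamentalLatticeRep 2).N × Fin (fundamentalLatticeRep 2).N × Bool → ℝ)), reb (a • v) = (a : ℂ) • reb v := fun a v => rebuild_smul a v
  have r_sum : ∀ f : (Edge 3 L × NoiseIdx (fundamentalLatticeRep 2).N) → (Edge 3 L × Fin (fundamentalLatticeRep 2).N × Fin (fundamentalLatticeRep 2).N × Bool → ℝ), reb (∑ k, f k) = ∑ k, reb (f k) :=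
    fun f => rebuild_sum Finset.univ f
  have r_inj : ∀ v w : (Edge 3 L × Fin (fundamentalLatticeRep 2).N × Fin (fundamentalLatticeRep 2).N × Bool → ℝ), reb v = reb w → v = w := fun v w h => eq_of_rebuild_eq h
  have r_flat : ∀ M : (Edge 3 L → Matrix (Fin (fundamentalLatticeRep 2).N) (Fin (fundamentalLatticeRep 2).N) ℂ), reb (flat M) = M := fun M => rebuild_flat_of M
  have r_σ : ∀ n z, reb (σ n z) = fun e => if n.1 = e then (Real.sqrt 2 : ℂ) • (P n.2 * reb z e) else 0 :=
    fun n z => rebuild_noise n z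
  have flat_reb : ∀ v : (Edge 3 L × Fin (fundamentalLatticeRep 2).N × Fin (fundamentalLatticeRep 2).N × Bool → ℝ), flat (reb v) = v := fun v => r_inj _ _ (r_flat _)
  -- the coefficients `x_n = Λ(s_n y)` and the combined field `S = Σ_n x_n s_n`
  set x : Edge 3 L × NoiseIdx (fundamentalLatticeRep 2).N → ℝ := fun n => Λ (s n y) with hx
  set S : (Edge 3 L × Fin (fundamentalLatticeRep 2).N × Fin (fundamentalLatticeRep 2).N × Bool → ℝ) →L[ℝ] (Edge 3 L × Fin (fundamentalLatticeRep 2).N × Fin (fundamentalLatticeRep 2).N × Bool → ℝ) := ∑ n, x n • s n with hSdef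
  have hS_apply : ∀ z, S z = ∑ n, x n • s n z := fun z => by
    rw [hSdef, _root_.sum_apply]
    simp only [FunLike.coe_smul, Pi.smul_apply]
  -- the matrices `Z_e = Σ_ν x_(e,ν) 𝐩E_ν ∈ 𝔤`, `A_e = √2 Z_e`, `Q_e = V_e`
  set Z : Edge 3 L → Matrix (Fin (fundamentalLatticeRep 2).N) (Fin (fundamentalLatticeRep 2).N) ℂ := fun e => ∑ ν, x (e, ν) • P ν with hZ
  set A : Edge 3 L → Matrix (Fin (fundamentalLatticeRep 2).N) (Fin (fundamentalLatticeRep 2).N) ℂ := fun e => (Real.sqrt 2 : ℂ) • Z e with hA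
  set Q : Edge 3 L → Matrix (Fin (fundamentalLatticeRep 2).N) (Fin (fundamentalLatticeRep 2).N) ℂ := fun e => Matrix.of fun i j : Fin (fundamentalLatticeRep 2).N =>
    (fundamentalRep (Fin 2) (V e) : Matrix (Fin 2) (Fin 2) ℂ) i j with hQ
  have hrebY : reb y = Q := rebuild_coords_of V
  have hyQ : flat Q = y := by rw [← hrebY, flat_reb]
  have hZmem : ∀ e, Z e ∈ (fundamentalLatticeRep 2).lieAlg := fun e =>
    Submodule.sum_mem _ fun ν _ => Submodule.smul_mem _ _ ((fundamentalLatticeRep 2).lieProj_mem _)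
  have hZskew : ∀ e, (Z e)ᴴ = -Z e := fun e => by
    rw [← Matrix.star_eq_conjTranspose]
    exact (fundamentalLatticeRep 2).star_eq_neg_of_mem_lieAlg (hZmem e)
  have hAskew : ∀ e, (A e)ᴴ = -A e := fun e => by
    simp only [hA, Matrix.conjTranspose_smul, RCLike.star_def, Complex.conj_ofReal, hZskew, smul_neg]
  have hQU : ∀ e, Q e ∈ Matrix.unitaryGroup (Fin (fundamentalLatticeRep 2).N) ℂ := fun e =>
    Matrix.specialUnitaryGroup_le_unitaryGroup (V e).2
  -- real vs complex scalars on matrices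
  have cx : ∀ (a : ℝ) (W : Matrix (Fin (fundamentalLatticeRep 2).N) (Fin (fundamentalLatticeRep 2).N) ℂ), a • W = (a : ℂ) • W := fun a W => by
    ext i j
    simp only [Matrix.smul_apply, Complex.real_smul, smul_eq_mul]
  -- (F1) `rebuild (S z) = (A_e · rebuild(z)_e)_e`, i.e. `S z = flat(A · rebuild z)`
  have hrebS : ∀ z, reb (S z) = fun e => A e * reb z e := by
    intro z
    rw [hS_apply, r_sum]
    simp_rw [r_smul, hsσ, r_σ]
    funext e
    rw [Finset.sum_apply]
    have hsplit : ∑ n : Edge 3 L × NoiseIdx (fundamentalLatticeRep 2).N,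
        ((x n : ℂ) • (fun e' : Edge 3 L => if n.1 = e' then (Real.sqrt 2 : ℂ) • (P n.2 * reb z e') else (0 : Matrix (Fin (fundamentalLatticeRep 2).N) (Fin (fundamentalLatticeRep 2).N) ℂ))) e
        = ∑ e' : Edge 3 L, ∑ ν : NoiseIdx (fundamentalLatticeRep 2).N,
          ((x (e', ν) : ℂ) • (fun e'' : Edge 3 L => if (e', ν).1 = e'' then (Real.sqrt 2 : ℂ) • (P (e', ν).2 * reb z e'') else (0 : Matrix (Fin (fundamentalLatticeRep 2).N) (Fin (fundamentalLatticeRep 2).N) ℂ))) e :=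
      Fintype.sum_prod_type _
    rw [hsplit, Finset.sum_eq_single e (fun e' _ hne => Finset.sum_eq_zero fun ν _ => by
      simp only [Pi.smul_apply, if_neg hne, smul_zero]) (fun h => absurd (Finset.mem_univ e) h)]
    simp only [Pi.smul_apply, if_true, hA, hZ, Finset.smul_sum, Finset.sum_mul, Matrix.smul_mul]
    refine Finset.sum_congr rfl fun ν _ => ?_
    rw [cx, smul_comm]
  have hSflat : ∀ z, S z = flat (fun e => A e * reb z e) := fun z =>
    r_inj _ _ ((hrebS z).trans (r_flat _).symm)
  -- `ψ̂(flat M) = β' · wilsonRe M`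
  have hψW : ∀ M : (Edge 3 L → Matrix (Fin (fundamentalLatticeRep 2).N) (Fin (fundamentalLatticeRep 2).N) ℂ), ψ (flat M) = β' * wilsonRe M := by
    intro M
    have h1 : ψ (flat M) = β' * ∑ p : Plaquette 3 L, (rootedLoop (reb (flat M)) (p.1, p.2.1.1) p.2.1.2 false).trace.re := rfl
    rw [h1, r_flat]
    simp only [wilsonRe, plaqRe, rootedLoop]
  have hψC : ContDiff ℝ 2 ψ := contDiff_psiHat (d := 3) (L := L) (N := (fundamentalLatticeRep 2).N) (n := 2) β'
  -- (F2) the second frame derivative is `β' · hessianForm Q A`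
  have hkey : fderiv ℝ (fun z => fderiv ℝ ψ z (S z)) y (S y) = β' * hessianForm Q A := by
    have h : fderiv ℝ (fun z => fderiv ℝ ψ z (S z)) (flat Q) (S (flat Q)) = β' * hessianForm Q A :=
      fderiv_frameDeriv_eq_mul_hessianForm Q A hAskew β' ψ hψC hψW S hSflat
    rw [hyQ] at h
    exact h
  -- (F3) bilinear expansion of the left side
  have hexp : fderiv ℝ (fun z => fderiv ℝ ψ z (S z)) y (S y)
      = ∑ n, ∑ m, x n * x m * fderiv ℝ (fun z => fderiv ℝ ψ z (s m z)) y (s n y) := by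
    have hGsum : (fun z => fderiv ℝ ψ z (S z)) = fun z => ∑ m, x m * fderiv ℝ ψ z (s m z) := by
      funext z
      rw [hS_apply, map_sum]
      exact Finset.sum_congr rfl fun m _ => by rw [map_smul, smul_eq_mul]
    rw [hGsum, fderiv_sum_mul_apply Finset.univ x (fun m _ => differentiableAt_frameDeriv hψC (s m) y) (S y)]
    simp_rw [hS_apply, map_sum, map_smul, smul_eq_mul, Finset.mul_sum]
    rw [Finset.sum_comm]
    refine Finset.sum_congr rfl fun n _ => Finset.sum_congr rfl fun m _ => ?_
    ring
  have hE : ∑ n, ∑ m, x n * x m * fderiv ℝ (fun z => fderiv ℝ ψ z (s m z)) y (s n y) = β' * hessianForm Q A := by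
    rw [← hexp]; exact hkey
  -- (F4) the Hessian-bound HYPOTHESIS `WilsonHessianBound 3 2 Λ₀` on this torus, along `t ↦ e^(tA)V`
  have hAtr : ∀ e, (A e).trace = 0 := fun e => by
    rw [hA, Matrix.trace_smul, trace_eq_zero_of_mem_lieAlg_two (hZmem e), smul_zero]
  have hH' : |hessianForm Q A| ≤ Λ₀ * tangentNormSq A := by
    have h := hH L V A hAskew hAtr
    have hW : wilsonPlaquetteSumAlong V A = fun t => wilsonRe (perturb Q A t) := rfl
    rw [hW, iteratedDeriv_two_wilsonRe Q A hAskew] at h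
    exact h
  -- (F5) `Σ_e ‖A_e‖² ≤ 2 Σ_n x_n²`
  have hT : tangentNormSq A ≤ 2 * ∑ n, x n ^ 2 := by
    have hTe : tangentNormSq A = ∑ e, hsForm (fundamentalLatticeRep 2).N (A e) (A e) := rfl
    have hAe : ∀ e, hsForm (fundamentalLatticeRep 2).N (A e) (A e) = 2 * hsForm (fundamentalLatticeRep 2).N (Z e) (Z e) := fun e => by
      show hsForm (fundamentalLatticeRep 2).N ((Real.sqrt 2 : ℂ) • Z e) ((Real.sqrt 2 : ℂ) • Z e) = _
      rw [hsForm_coe_smul_left, hsForm_coe_smul_right, ← mul_assoc, Real.mul_self_sqrt zero_le_two]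
    have hZe : ∀ e, hsForm (fundamentalLatticeRep 2).N (Z e) (Z e) ≤ ∑ ν, x (e, ν) ^ 2 := fun e => by
      have hZp : Z e = (fundamentalLatticeRep 2).lieProj (∑ ν, x (e, ν) • noiseDir ν) := by
        show ∑ ν, x (e, ν) • P ν = _
        rw [map_sum]
        simp only [map_smul, hP]
      rw [hZp, ← hsForm_sum_smul_noiseDir_self]
      exact hsForm_lieProj_self_le (fundamentalLatticeRep 2) _
    have hsum : ∑ e, hsForm (fundamentalLatticeRep 2).N (Z e) (Z e) ≤ ∑ e : Edge 3 L, ∑ ν : NoiseIdx (fundamentalLatticeRep 2).N, x (e, ν) ^ 2 :=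
      Finset.sum_le_sum fun e _ => hZe e
    have hprod : ∑ n, x n ^ 2 = ∑ e : Edge 3 L, ∑ ν : NoiseIdx (fundamentalLatticeRep 2).N, x (e, ν) ^ 2 :=
      Fintype.sum_prod_type (fun n : Edge 3 L × NoiseIdx (fundamentalLatticeRep 2).N => x n ^ 2)
    rw [hTe, hprod, Finset.sum_congr rfl fun e _ => hAe e, ← Finset.mul_sum]
    linarith
  -- assembly
  have hxn : 0 ≤ ∑ n, x n ^ 2 := Finset.sum_nonneg fun n _ => sq_nonneg _
  have main : ∑ n, ∑ m, x n * x m * fderiv ℝ (fun z => fderiv ℝ ψ z (s m z)) y (s n y) ≤ 2 * Λ₀ * |β'| * ∑ n, x n ^ 2 := by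
    rw [hE]
    calc β' * hessianForm Q A ≤ |β' * hessianForm Q A| := le_abs_self _
      _ = |β'| * |hessianForm Q A| := abs_mul _ _
      _ ≤ |β'| * (Λ₀ * tangentNormSq A) := mul_le_mul_of_nonneg_left hH' (abs_nonneg _)
      _ ≤ |β'| * (Λ₀ * (2 * ∑ n, x n ^ 2)) :=
          mul_le_mul_of_nonneg_left (mul_le_mul_of_nonneg_left hT hΛ) (abs_nonneg _)
      _ = 2 * Λ₀ * |β'| * ∑ n, x n ^ 2 := by ring
  -- back to the statement's vocabulary
  have hsz : ∀ k : Edge 3 L × NoiseIdx (fundamentalLatticeRep 2).N, (fun z : (Edge 3 L × Fin (fundamentalLatticeRep 2).N × Fin (fundamentalLatticeRep 2).N × Bool → ℝ) => fderiv ℝ ψ z (s k z)) = fun z => fderiv ℝ ψ z (σ k z) :=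
    fun k => funext fun z => congrArg (fderiv ℝ ψ z) (hs k z)
  have hsV : ∀ k : Edge 3 L × NoiseIdx (fundamentalLatticeRep 2).N, s k y = σ k y := fun k => hs k y
  simp only [hx, hsz, hsV] at main
  exact main

/-! ## §2. The named fact -/

/-- ★★★ **THE NAMED FACT `shenZhuZhu_bakryEmery_transfer 3 2` IS A THEOREM: Shen–Zhu–Zhu's Bakry–Émery step for `SU(2)`, `d = 3`.**
For every `Λ₀ ≥ 0` such that the Wilson plaquette sum has `|Hess(v,v)| ≤ Λ₀|v|²` on every torus (`WilsonHessianBound 3 2 Λ₀`) and every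
't Hooft coupling `β` with `K = N/2 − N|β|Λ₀ = 1 − 2|β|Λ₀ > 0`: every infinite-volume limit point of the torus `SU(2)` Wilson states at tree
coupling `2β` satisfies the log-Sobolev inequality `Ent_μ(F²) ≤ (2/K)Σ_e L_e²` and the Poincaré inequality `Var_μ(F) ≤ (1/K)Σ_e L_e²` for all
smooth cylinder functions `L_e`-Lipschitz in the link `e` (`SZZFunctionalInequalitiesWith 3 2 β K`).  Proof: `hessBound_of_wilsonHessianBound`
(frame-Hessian bound `K₀ = 2Λ₀|2β| = 4Λ₀|β| < 2` on every torus) and `szzFunctionalInequalitiesWith_su2_of_hessBound` (torus log-Sobolev /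
Poincaré in Lipschitz form, uniform in the volume, then the weak limit along tori).  HONEST FRAMING: strong coupling, fixed lattice.
[cite: ShenZhuZhu2022, §4 Theorem 4.2, (4.7)–(4.8), Corollary 4.4 (4.11), Corollary 4.5 (4.12)–(4.13)] -/
theorem shenZhuZhu_bakryEmery_transfer_su2_d3 : shenZhuZhu_bakryEmery_transfer 3 2 := by
  intro Λ₀ hΛ hH _hd _hN β hK
  have h2 : |((2 : ℕ) : ℝ) * β| = 2 * |β| := by
    rw [abs_mul, Nat.cast_ofNat, abs_of_pos (by norm_num : (0 : ℝ) < 2)]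
  have hK' : 0 < 1 - 2 * |β| * Λ₀ := by
    have e : ((2 : ℕ) : ℝ) / 2 - ((2 : ℕ) : ℝ) * |β| * Λ₀ = 1 - 2 * |β| * Λ₀ := by push_cast; ring
    rw [e] at hK; exact hK
  have hK0 : 2 * Λ₀ * |((2 : ℕ) : ℝ) * β| < 2 := by
    rw [h2]; nlinarith [abs_nonneg β]
  have h := szzFunctionalInequalitiesWith_su2_of_hessBound β (2 * Λ₀ * |((2 : ℕ) : ℝ) * β|) hK0
    (fun L _ => hessBound_of_wilsonHessianBound Λ₀ hΛ hH L (((2 : ℕ) : ℝ) * β))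
  have e : ((2 : ℕ) : ℝ) / 2 - ((2 : ℕ) : ℝ) * |β| * Λ₀ = 1 - 2 * Λ₀ * |((2 : ℕ) : ℝ) * β| / 2 := by
    rw [h2]; push_cast; ring
  rw [e]
  exact h

end Summit.QuantumFields.YangMills.Theorems.ColdStartUniversality
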